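import Summits.QuantumFields.YangMills.Theorems.AlphaInputsT3ACv3Prop1Blocks
import Summits.QuantumFields.YangMills.Theorems.BalabanUVNodesN18TransportedPairGcValuedAllBonds
import HarnessLib

/-!
# BalabanUVNodes ∕ node N18 = NE5 — closure-ledger item (iii): THE (1.11) LETTERS OF THE AVERAGED FACTOR AT THE TABLE OF RECORD — the (0.4) average `Ū` of
# the `SU(N)`-valued factor `U` of run B's condition (i) is `SU(N)`-VALUED at every two-block-interior coarse bond and has `|∂Ū − 1| ≤ L²α₀ξ² + C₀(L²α₀ξ²)²` at
# every four-block-interior coarse plaquette, from (1.11) of `U` on run B's region ONLY; read through W1-18's level identification at every frame bond ∕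
# plaquette of run A's domain `Y`
# (Track A, DAG node N18 = `T4OutputRate.NE5` :211; cluster K4 «SpineRates», item K3⁷ `SpineGivenEndpointR13SepCoPH`; seat pub-ymgap-dag-n18-w3 g4)

HONEST FRAMING.  Count-neutral kernel bookkeeping (`--supports stmt-QuantumFields-20544 --as helper`): composition BY NAME of the `pub-balaban3d` lane's box-local Stokes
and LOCAL sharp Proposition 1 for (0.4) (`Summit.QuantumFields.YangMills.Theorems.BoxStokes.small_of_plaqSmallOn_twoBlock` ∕ `dist1_plaqHol_avgFun_le_fourBlock`,
modules `AlphaInputsT3ACv3BoxStokes` ∕ `…FourBlockGeom` ∕ `…Prop1Blocks` — [Balaban1985Averaging] Prop. 1 (51) with the printed locality «p ⊂ Δ(p′)»), W1-18's `(T1)` kernel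
`avgUnits_ιSU`, UST's two-block locality `emlAvgU_congr₂`, and FILE B's run-A∕run-B dictionary.  These are the `gValued` and `plaq_lt` fields of `CondI` for the candidate factor `U_A := fieldShift (avgUnits U)`
of `Ū = TΦOfRecord(Φ).U` in FILE 7's `hletters` (`…N18TransportLettersOfRecord`); the `localGauge` field ((1.12) one run up — this seat's g2 `…N18LocalGaugeOnTransport`
in `Sect2.LocalGaugeOn` currency), the factorisation `Ū = (exp iξ′A′)·U_A` and the letters of `A′` ([Balaban1985Averaging] Prop. 3) are NOT here.  Nothing of Bałaban's
renormalization group is asserted; NE5 NOT PRINTED ∕ NOT proved; N18 NOT discharged; nothing about the continuum ∕ OS ∕ mass gap ∕ Clay.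

WHAT (run B = `P`, a frame `FB` with constants `cB` and condition (i) `CondI (suModel N) FB cB α₀ U` for the factor `U : PBond P 0 → M_N(ℂ)ˣ`).
* §1 `exists_su_lift` (the factor is `ιSU ∘ V` on the region's bonds for some `SU(N)`-valued `V`), `val_plaq_ιSU` ∕ `norm_plaq_ιSU_sub_one` (bridge `plaq (ιSU ∘ V)` ↔
  `dist1 (V(∂q))`), `plaq_congr_of_bonds`, `dist1_plaqHol_lift_lt` (`|V(∂q) − 1| < α₀ξ²` on the region's plaquettes whose bonds are region bonds), `blockOf_corners_mem_pair`
  (in the two-block product set the extreme corners of a plaquette control the other two — twin of the lane's `blockOf_corners_mem_four`).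
* §2 ★ `small_lift_of_condI` (the guard of the (0.4) average of record at `c` from (1.11) on the two blocks: `(((d+2)L)²∕4)·α₀ξ² < δ_N`), ★★ `avgUnits_factor_eq_ιSU_avgFun`
  (`Ū(c) = ιSU (avgFun expMeanLogSU V c)`), ★★ `avgUnits_factor_mem_suModel_G` (`Ū(c) ∈ SU(N)`).
* §3 `plaq_fieldShift` (plaquette variables under the level identification, units-valued twin of module 13's `plaqHol_fieldShift₄`), ★★★ `norm_plaq_avgUnits_factor_sub_one_le`
  (`‖∂Ū(p′) − 1‖ ≤ L²·(α₀ξ²) + 143·((((d+4)L)²∕4)·(α₀ξ²))²` at a coarse plaquette whose four blocks' bonds and plaquettes lie in the region, `(((d+4)L)²∕4)·α₀ξ² ≤ δ_N∕2`).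
* §4 at the frames of record: `fourBlocks_subset_bonds_preimage`, `fourBlocks_subset_plaqs_preimage` (the four-corner twins of FILE B's dictionary), ★★★★
  `fieldShift_avgUnits_factor_mem_G_frameBond` and ★★★★ `norm_plaq_fieldShift_avgUnits_factor_sub_one_le_framePlaq`: for `Y ∈ 𝐃_j` of run A and the factor `U` of a
  pair satisfying (i) of run B on `frameI Rz M (j+1) (domSites π(j,Y))`, the field `fieldShift (avgUnits U)` is `SU(N)`-valued at EVERY bond of `regionOfSet (domSites Y)` and
  its plaquette variables at EVERY plaquette of `regionOfSet (domSites Y)` are within `L²·(α₀ξ²) + 143·((((d+4)L)²∕4)·(α₀ξ²))²` of `1`.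

0 `def`, 0 `sorry`.  References: T. Bałaban, CMP **109** (1987) 249–301 [Balaban1987RG1] ((0.4) p.253, (0.24)–(0.25) p.257, (1.11)–(1.12) p.262); CMP **98** (1985) 17–51
[Balaban1985Averaging] (Prop. 1 (51) p.26, (46) p.25).
-/

noncomputable section

open scoped BigOperators Matrix.Norms.L2Operator

namespace YMDAG.N18.TransportOfRecord

open Literature.MathematicalPhysics.QuantumFieldTheory.Balaban1983to89
open Literature.MathematicalPhysics.QuantumFieldTheory.Balaban1983to89.T4Continuum
open Literature.MathematicalPhysics.QuantumFieldTheory.Balaban1983to89.T4LevelShift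
open Literature.MathematicalPhysics.QuantumFieldTheory.Balaban1983to89.BlockAveraging
open Literature.MathematicalPhysics.QuantumFieldTheory.Balaban1983to89.B12RegularSpaces111
open Literature.MathematicalPhysics.QuantumFieldTheory.Balaban1983to89.B12RegularSpaces111SpecialUnitary (suModel mem_suModel_G suModel_norm_le)
open Literature.MathematicalPhysics.QuantumFieldTheory.Balaban1983to89.ExpMeanLog (expMeanLogSU deltaSU expMeanLogSU_δ)
open Literature.MathematicalPhysics.QuantumFieldTheory.Balaban1983to89.Node00 (MatA ιSU coe_ιSU ιSU_mem_G)
open Literature.MathematicalPhysics.QuantumFieldTheory.Balaban1983to89.Node00.W1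
open Literature.MathematicalPhysics.QuantumFieldTheory.Balaban1983to89.Node00.Sect2 (regionOfSet domSys domSites frameI)
open Summit.QuantumFields.YangMills.Theorems.Prop8Chart (emlAvgU_congr₂)
open Summit.QuantumFields.YangMills.Theorems.BoxStokes (small_of_plaqSmallOn_twoBlock dist1_plaqHol_avgFun_le_fourBlock blockOf_corners_mem_four blockOf_mem_pair_iff
  walkEnd_single_mem_pi)

/-! ## §1 The `SU(N)` lift of the factor on the region -/

section Lift

variable {P : Params} {N : ℕ} [NeZero N]

omit [NeZero N] in
/-- **The factor of condition (i) is `ιSU ∘ V` on the region's bonds for an `SU(N)`-valued `V`** («U has values in the group G» on `X`; off `X` the lift is `1`).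
[cite: Balaban1987RG1, (1.11) p.262] -/
theorem exists_su_lift {FB : Frame P 0 (MatA N)} {cB : StepConsts} {α₀ : ℝ} {U : PBond P 0 → (MatA N)ˣ} (hI : CondI (suModel N) FB cB α₀ U) :
    ∃ V : GaugeField P 0 (Node00.SU N), ∀ b ∈ FB.X.bonds, U b = ιSU N (V b) := by
  classical
  refine ⟨fun b => if h : U b ∈ (suModel N).G then ⟨(U b : MatA N), mem_suModel_G.mp h⟩ else 1, fun b hb => ?_⟩
  have h := hI.gValued b hb
  refine Units.ext ?_
  rw [coe_ιSU]
  simp only [dif_pos h]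

/-- The plaquette variable of `ιSU ∘ V`, read in `M_N(ℂ)`, IS the matrix of `V(∂q)` (`ιSU` is a monoid morphism, `coe_ιSU`). [cite: Balaban1987RG1, (1.11) p.262 (bookkeeping)] -/
theorem val_plaq_ιSU {j : ℕ} (V : GaugeField P j (Node00.SU N)) (q : Plaq P j) :
    ((plaq (fun b => ιSU N (V b)) q : (MatA N)ˣ) : MatA N) = ((GaugeField.plaqHol V q : Node00.SU N) : MatA N) := by
  rw [plaq_eq, ← map_inv, ← map_inv, ← map_mul, ← map_mul, ← map_mul, coe_ιSU]
  rfl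

/-- **`‖∂(ιSU ∘ V)(q) − 1‖ = dist1 (V(∂q))`** (`dist1 W = ‖W − 1‖_op` on `SU(N)`). [cite: Balaban1985Averaging, (19) p.21] -/
theorem norm_plaq_ιSU_sub_one {j : ℕ} (V : GaugeField P j (Node00.SU N)) (q : Plaq P j) :
    ‖((plaq (fun b => ιSU N (V b)) q : (MatA N)ˣ) : MatA N) - 1‖ = dist1 (GaugeField.plaqHol V q) := by
  rw [val_plaq_ιSU]
  rfl

omit [NeZero N] in
/-- In the two-block product set `B(c₋) ∪ B(c₊)`, the extreme corners of a plaquette control the other two (coordinate mixing; twin of the lane's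
`blockOf_corners_mem_four`). [folklore] -/
theorem blockOf_corners_mem_pair {j : ℕ} (c : PBond P (j + 1)) (q : Plaq P j) (h1 : blockOf q.src = c.src ∨ blockOf q.src = c.tgt)
    (h2 : blockOf ((q.src.shift q.μ).shift q.ν) = c.src ∨ blockOf ((q.src.shift q.μ).shift q.ν) = c.tgt) :
    (blockOf (q.src.shift q.μ) = c.src ∨ blockOf (q.src.shift q.μ) = c.tgt) ∧ (blockOf (q.src.shift q.ν) = c.src ∨ blockOf (q.src.shift q.ν) = c.tgt) := by
  have hne : ((q.μ, true) : Letter P.d).1 ≠ ((q.ν, true) : Letter P.d).1 := ne_of_lt q.hμν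
  have e1 : q.src.shift q.μ = walkEnd q.src [(q.μ, true)] := rfl
  have e2 : q.src.shift q.ν = walkEnd q.src [(q.ν, true)] := rfl
  have e3 : (q.src.shift q.μ).shift q.ν = walkEnd q.src [(q.μ, true), (q.ν, true)] := rfl
  rw [e3] at h2
  obtain ⟨hμ', hν'⟩ := walkEnd_single_mem_pi hne ((blockOf_mem_pair_iff c _).1 h1) ((blockOf_mem_pair_iff c _).1 h2)
  rw [e1, e2]
  exact ⟨(blockOf_mem_pair_iff c _).2 hμ', (blockOf_mem_pair_iff c _).2 hν'⟩

omit [NeZero N] in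
/-- A plaquette variable depends only on the four bond variables of the plaquette. [cite: Balaban1987RG1, (1.11) p.262 (bookkeeping)] -/
theorem plaq_congr_of_bonds {j : ℕ} {M : Type*} [Group M] {U U' : PBond P j → M} (q : Plaq P j)
    (h1 : U ⟨q.src, q.μ⟩ = U' ⟨q.src, q.μ⟩) (h2 : U ⟨q.src.shift q.μ, q.ν⟩ = U' ⟨q.src.shift q.μ, q.ν⟩)
    (h3 : U ⟨q.src.shift q.ν, q.μ⟩ = U' ⟨q.src.shift q.ν, q.μ⟩) (h4 : U ⟨q.src, q.ν⟩ = U' ⟨q.src, q.ν⟩) : plaq U q = plaq U' q := by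
  rw [plaq_eq, plaq_eq, h1, h2, h3, h4]

/-- **(1.11) for the lift**: at a plaquette of the region whose four bonds are bonds of the region, `|V(∂q) − 1| < α₀ξ²` (`dist1` on `SU(N)` = the operator-norm distance of
the matrix, and `∂(ιSU ∘ V) = ιSU (∂V)`). [cite: Balaban1987RG1, (1.11) p.262] -/
theorem dist1_plaqHol_lift_lt {FB : Frame P 0 (MatA N)} {cB : StepConsts} {α₀ : ℝ} {U : PBond P 0 → (MatA N)ˣ} (hI : CondI (suModel N) FB cB α₀ U)
    {V : GaugeField P 0 (Node00.SU N)} (hV : ∀ b ∈ FB.X.bonds, U b = ιSU N (V b)) (q : Plaq P 0) (hq : q ∈ FB.X.plaqs)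
    (h1 : (⟨q.src, q.μ⟩ : PBond P 0) ∈ FB.X.bonds) (h2 : (⟨q.src.shift q.μ, q.ν⟩ : PBond P 0) ∈ FB.X.bonds)
    (h3 : (⟨q.src.shift q.ν, q.μ⟩ : PBond P 0) ∈ FB.X.bonds) (h4 : (⟨q.src, q.ν⟩ : PBond P 0) ∈ FB.X.bonds) :
    dist1 (GaugeField.plaqHol V q) < α₀ * cB.ξ ^ 2 := by
  have h := hI.plaq_lt q hq
  rw [plaq_congr_of_bonds (U' := fun b => ιSU N (V b)) q (hV _ h1) (hV _ h2) (hV _ h3) (hV _ h4)] at h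
  rw [← norm_plaq_ιSU_sub_one]
  exact h

end Lift

/-! ## §2 The averaged factor is `SU(N)`-valued where its two blocks lie in the region -/

section TwoBlocks

variable {P : Params} {N : ℕ} [NeZero N]

/-- ★ **THE GUARD OF THE (0.4) AVERAGE OF RECORD FROM (1.11) ON THE TWO BLOCKS**: if the two-block bonds and plaquettes of the coarse bond `c` lie in the region and
`(((d+2)L)²∕4)·α₀ξ² < δ_N`, every loop variable of the lift `V` at `c` is `δ_N`-small (`BlockAveraging.Small expMeanLogSU V c`) — the `pub-balaban3d` lane's two-block
box Stokes `BoxStokes.small_of_plaqSmallOn_twoBlock` (whose plaquette hypothesis asks only the extreme corners in the two blocks, `blockOf_corners_mem_pair`).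
[cite: Balaban1987RG1, (0.4) p.253 and (1.11) p.262] -/
theorem small_lift_of_condI (hj : 0 + 1 ≤ P.m + P.K) {FB : Frame P 0 (MatA N)} {cB : StepConsts} {α₀ : ℝ} {U : PBond P 0 → (MatA N)ˣ}
    (hI : CondI (suModel N) FB cB α₀ U) {V : GaugeField P 0 (Node00.SU N)} (hV : ∀ b ∈ FB.X.bonds, U b = ιSU N (V b)) (c : PBond P 1)
    (hXb : ∀ b : PBond P 0, (blockOf b.src = c.src ∨ blockOf b.src = c.tgt) → (blockOf b.tgt = c.src ∨ blockOf b.tgt = c.tgt) → b ∈ FB.X.bonds)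
    (hXp : ∀ p : Plaq P 0, (blockOf p.src = c.src ∨ blockOf p.src = c.tgt) →
      (blockOf (p.src.shift p.μ) = c.src ∨ blockOf (p.src.shift p.μ) = c.tgt) →
      (blockOf (p.src.shift p.ν) = c.src ∨ blockOf (p.src.shift p.ν) = c.tgt) →
      (blockOf ((p.src.shift p.μ).shift p.ν) = c.src ∨ blockOf ((p.src.shift p.μ).shift p.ν) = c.tgt) → p ∈ FB.X.plaqs)
    (hα₀ : 0 ≤ α₀) (hguard : ((((P.d + 2) * P.L : ℕ) : ℝ) ^ 2 / 4) * (α₀ * cB.ξ ^ 2) < deltaSU (Fin N)) :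
    Small (expMeanLogSU (n := Fin N)) V c := by
  refine small_of_plaqSmallOn_twoBlock hj _ (mul_nonneg hα₀ (sq_nonneg cB.ξ)) c (fun p h1 h4 => ?_) hguard
  obtain ⟨h2, h3⟩ := blockOf_corners_mem_pair c p h1 h4
  exact (dist1_plaqHol_lift_lt hI hV p (hXp p h1 h2 h3 h4) (hXb _ h1 h2) (hXb _ h2 h4)
    (hXb _ h3 (by rw [PBond.tgt, BlockAveragingEMLProp2.shift_shift_comm p.src p.ν p.μ]; exact h4)) (hXb _ h1 h3)).le

/-- ★★ **THE (0.4) AVERAGE OF THE FACTOR IS `ιSU` OF THE (0.4) AVERAGE OF RECORD OF ITS LIFT**: `avgUnits U c = ιSU (avgFun expMeanLogSU V c)` — two-block locality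
(UST `emlAvgU_congr₂`: `U` and `ιSU ∘ V` agree on the two-block bonds) + W1-18's (T1) kernel `avgUnits_ιSU` on the guard of ★. [cite: Balaban1987RG1, (0.4) p.253] -/
theorem avgUnits_factor_eq_ιSU_avgFun (hj : 0 + 1 ≤ P.m + P.K) {FB : Frame P 0 (MatA N)} {cB : StepConsts} {α₀ : ℝ} {U : PBond P 0 → (MatA N)ˣ}
    (hI : CondI (suModel N) FB cB α₀ U) {V : GaugeField P 0 (Node00.SU N)} (hV : ∀ b ∈ FB.X.bonds, U b = ιSU N (V b)) (c : PBond P 1)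
    (hXb : ∀ b : PBond P 0, (blockOf b.src = c.src ∨ blockOf b.src = c.tgt) → (blockOf b.tgt = c.src ∨ blockOf b.tgt = c.tgt) → b ∈ FB.X.bonds)
    (hXp : ∀ p : Plaq P 0, (blockOf p.src = c.src ∨ blockOf p.src = c.tgt) →
      (blockOf (p.src.shift p.μ) = c.src ∨ blockOf (p.src.shift p.μ) = c.tgt) →
      (blockOf (p.src.shift p.ν) = c.src ∨ blockOf (p.src.shift p.ν) = c.tgt) →
      (blockOf ((p.src.shift p.μ).shift p.ν) = c.src ∨ blockOf ((p.src.shift p.μ).shift p.ν) = c.tgt) → p ∈ FB.X.plaqs)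
    (hα₀ : 0 ≤ α₀) (hguard : ((((P.d + 2) * P.L : ℕ) : ℝ) ^ 2 / 4) * (α₀ * cB.ξ ^ 2) < deltaSU (Fin N)) :
    avgUnits U c = ιSU N (avgFun (expMeanLogSU (n := Fin N)) V c) := by
  have hagree : ∀ b : PBond P 0, (blockOf b.src = c.src ∨ blockOf b.src = c.tgt) → (blockOf b.tgt = c.src ∨ blockOf b.tgt = c.tgt) →
      U b = (fun b => ιSU N (V b)) b := fun b h1 h2 => hV b (hXb b h1 h2)
  rw [show avgUnits U c = avgUnits (fun b => ιSU N (V b)) c from emlAvgU_congr₂ hj c hagree]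
  exact avgUnits_ιSU V c (small_lift_of_condI hj hI hV c hXb hXp hα₀ hguard)

/-- ★★ **THE AVERAGED FACTOR IS `SU(N)`-VALUED** at every coarse bond whose two-block bonds and plaquettes lie in the region (the `gValued` field of (i) one run up, at
that bond). [cite: Balaban1987RG1, (1.11) p.262 and (0.4) p.253] -/
theorem avgUnits_factor_mem_suModel_G (hj : 0 + 1 ≤ P.m + P.K) {FB : Frame P 0 (MatA N)} {cB : StepConsts} {α₀ : ℝ} {U : PBond P 0 → (MatA N)ˣ}
    (hI : CondI (suModel N) FB cB α₀ U) (c : PBond P 1)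
    (hXb : ∀ b : PBond P 0, (blockOf b.src = c.src ∨ blockOf b.src = c.tgt) → (blockOf b.tgt = c.src ∨ blockOf b.tgt = c.tgt) → b ∈ FB.X.bonds)
    (hXp : ∀ p : Plaq P 0, (blockOf p.src = c.src ∨ blockOf p.src = c.tgt) →
      (blockOf (p.src.shift p.μ) = c.src ∨ blockOf (p.src.shift p.μ) = c.tgt) →
      (blockOf (p.src.shift p.ν) = c.src ∨ blockOf (p.src.shift p.ν) = c.tgt) →
      (blockOf ((p.src.shift p.μ).shift p.ν) = c.src ∨ blockOf ((p.src.shift p.μ).shift p.ν) = c.tgt) → p ∈ FB.X.plaqs)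
    (hα₀ : 0 ≤ α₀) (hguard : ((((P.d + 2) * P.L : ℕ) : ℝ) ^ 2 / 4) * (α₀ * cB.ξ ^ 2) < deltaSU (Fin N)) :
    avgUnits U c ∈ (suModel N).G := by
  obtain ⟨V, hV⟩ := exists_su_lift hI
  rw [avgUnits_factor_eq_ιSU_avgFun hj hI hV c hXb hXp hα₀ hguard]
  exact ιSU_mem_G N _

end TwoBlocks

/-! ## §3 The plaquette variables of the averaged factor where the four blocks lie in the region -/

section FourBlocks

variable {P : Params} {N : ℕ} [NeZero N]

/-- ★★★ **(1.11) FOR THE AVERAGED FACTOR, LOCALLY**: at a coarse plaquette `p′ = ⟨y; μ, ν⟩` whose four blocks `Δ(p′)` have their bonds and plaquettes in run B's region,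
`‖∂Ū(p′) − 1‖ ≤ L²·(α₀ξ²) + 143·((((d+4)L)²∕4)·(α₀ξ²))²` for `Ū = avgUnits U` — the four bond averages are `ιSU` of the averages of record of the lift (§2 ★★), and
the `pub-balaban3d` lane's LOCAL sharp Proposition 1 `BoxStokes.dist1_plaqHol_avgFun_le_fourBlock` ([Balaban1985Averaging] (51) with the printed locality «p ⊂ Δ(p′)»)
bounds `∂` of the latter from (1.11) of the lift on `Δ(p′)` (`(((d+4)L)²∕4)·α₀ξ² ≤ δ_N∕2`). [cite: Balaban1985Averaging, Prop. 1 (51) p.26, (46) p.25; Balaban1987RG1, (1.11) p.262] -/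
theorem norm_plaq_avgUnits_factor_sub_one_le (hj : 0 + 1 ≤ P.m + P.K) {FB : Frame P 0 (MatA N)} {cB : StepConsts} {α₀ : ℝ} {U : PBond P 0 → (MatA N)ˣ}
    (hI : CondI (suModel N) FB cB α₀ U) (p' : Plaq P 1)
    (hXb : ∀ b : PBond P 0,
      (blockOf b.src = p'.src ∨ blockOf b.src = p'.src.shift p'.μ ∨ blockOf b.src = p'.src.shift p'.ν ∨ blockOf b.src = (p'.src.shift p'.μ).shift p'.ν) →
      (blockOf b.tgt = p'.src ∨ blockOf b.tgt = p'.src.shift p'.μ ∨ blockOf b.tgt = p'.src.shift p'.ν ∨ blockOf b.tgt = (p'.src.shift p'.μ).shift p'.ν) →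
      b ∈ FB.X.bonds)
    (hXp : ∀ q : Plaq P 0,
      (blockOf q.src = p'.src ∨ blockOf q.src = p'.src.shift p'.μ ∨ blockOf q.src = p'.src.shift p'.ν ∨ blockOf q.src = (p'.src.shift p'.μ).shift p'.ν) →
      (blockOf (q.src.shift q.μ) = p'.src ∨ blockOf (q.src.shift q.μ) = p'.src.shift p'.μ ∨ blockOf (q.src.shift q.μ) = p'.src.shift p'.ν ∨
        blockOf (q.src.shift q.μ) = (p'.src.shift p'.μ).shift p'.ν) →
      (blockOf (q.src.shift q.ν) = p'.src ∨ blockOf (q.src.shift q.ν) = p'.src.shift p'.μ ∨ blockOf (q.src.shift q.ν) = p'.src.shift p'.ν ∨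
        blockOf (q.src.shift q.ν) = (p'.src.shift p'.μ).shift p'.ν) →
      (blockOf ((q.src.shift q.μ).shift q.ν) = p'.src ∨ blockOf ((q.src.shift q.μ).shift q.ν) = p'.src.shift p'.μ ∨
        blockOf ((q.src.shift q.μ).shift q.ν) = p'.src.shift p'.ν ∨ blockOf ((q.src.shift q.μ).shift q.ν) = (p'.src.shift p'.μ).shift p'.ν) →
      q ∈ FB.X.plaqs)
    (hα₀ : 0 ≤ α₀) (hguard : ((((P.d + 4) * P.L : ℕ) : ℝ) ^ 2 / 4) * (α₀ * cB.ξ ^ 2) ≤ deltaSU (Fin N) / 2) :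
    ‖((plaq (avgUnits U) p' : (MatA N)ˣ) : MatA N) - 1‖ ≤
      (P.L : ℝ) ^ 2 * (α₀ * cB.ξ ^ 2) + 143 * (((((P.d + 4) * P.L : ℕ) : ℝ) ^ 2 / 4) * (α₀ * cB.ξ ^ 2)) ^ 2 := by
  obtain ⟨V, hV⟩ := exists_su_lift hI
  obtain ⟨y, μ, ν, hμν⟩ := p'
  dsimp only at hXb hXp
  have hδ0 : 0 < deltaSU (Fin N) := ExpMeanLog.deltaSU_pos
  -- the two-block guard at each of the four bonds follows from the four-block one
  have hg2 : ((((P.d + 2) * P.L : ℕ) : ℝ) ^ 2 / 4) * (α₀ * cB.ξ ^ 2) < deltaSU (Fin N) := by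
    have hle : ((((P.d + 2) * P.L : ℕ) : ℝ) ^ 2 / 4) * (α₀ * cB.ξ ^ 2) ≤ ((((P.d + 4) * P.L : ℕ) : ℝ) ^ 2 / 4) * (α₀ * cB.ξ ^ 2) := by
      apply mul_le_mul_of_nonneg_right _ (mul_nonneg hα₀ (sq_nonneg _))
      apply div_le_div_of_nonneg_right _ (by norm_num)
      exact_mod_cast Nat.pow_le_pow_left (Nat.mul_le_mul_right P.L (by omega : P.d + 2 ≤ P.d + 4)) 2
    linarith
  -- the four bond averages
  have hbond : ∀ c : PBond P 1,
      (∀ x : Site P 0, (blockOf x = c.src ∨ blockOf x = c.tgt) →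
        (blockOf x = y ∨ blockOf x = y.shift μ ∨ blockOf x = y.shift ν ∨ blockOf x = (y.shift μ).shift ν)) →
      avgUnits U c = ιSU N (avgFun (expMeanLogSU (n := Fin N)) V c) := fun c hc =>
    avgUnits_factor_eq_ιSU_avgFun hj hI hV c (fun b h1 h2 => hXb b (hc _ h1) (hc _ h2))
      (fun q h1 h2 h3 h4 => hXp q (hc _ h1) (hc _ h2) (hc _ h3) (hc _ h4)) hα₀ hg2
  have e1 := hbond ⟨y, μ⟩ fun x h => h.elim Or.inl fun h => Or.inr (Or.inl h)
  have e2 := hbond ⟨y.shift μ, ν⟩ fun x h => h.elim (fun h => Or.inr (Or.inl h)) fun h => Or.inr (Or.inr (Or.inr h))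
  have e3 := hbond ⟨y.shift ν, μ⟩ fun x h => h.elim (fun h => Or.inr (Or.inr (Or.inl h))) fun h => Or.inr (Or.inr (Or.inr (by
    rw [h]; exact BlockAveragingEMLProp2.shift_shift_comm y ν μ)))
  have e4 := hbond ⟨y, ν⟩ fun x h => h.elim Or.inl fun h => Or.inr (Or.inr (Or.inl h))
  -- `∂Ū(p′) = ιSU (∂(avgFun V)(p′))`
  have hplaq : plaq (avgUnits U) ⟨y, μ, ν, hμν⟩ = ιSU N (GaugeField.plaqHol (avgFun (expMeanLogSU (n := Fin N)) V) ⟨y, μ, ν, hμν⟩) := by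
    rw [plaq_eq]
    show avgUnits U ⟨y, μ⟩ * avgUnits U ⟨y.shift μ, ν⟩ * (avgUnits U ⟨y.shift ν, μ⟩)⁻¹ * (avgUnits U ⟨y, ν⟩)⁻¹ = _
    rw [e1, e2, e3, e4, ← map_inv, ← map_inv, ← map_mul, ← map_mul, ← map_mul]
    rfl
  rw [hplaq, coe_ιSU]
  -- the local sharp Proposition 1 on the lift
  refine dist1_plaqHol_avgFun_le_fourBlock hj (mul_nonneg hα₀ (sq_nonneg cB.ξ)) (U := V) hguard y hμν (fun q h1 h4 => ?_)
  obtain ⟨h2, h3⟩ := blockOf_corners_mem_four y hμν.ne q h1 h4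
  exact (dist1_plaqHol_lift_lt hI hV q (hXp q h1 h2 h3 h4) (hXb _ h1 h2) (hXb _ h2 h4)
    (hXb _ h3 (by rw [PBond.tgt, BlockAveragingEMLProp2.shift_shift_comm q.src q.ν q.μ]; exact h4)) (hXb _ h1 h3)).le

end FourBlocks

/-! ## §4 At the frames of record: every frame bond and every frame plaquette of run A's domain -/

section Record

variable {F : T4Family} {N k : ℕ} [NeZero N]

/-- **Plaquette variables under the level identification** (units-valued twin of module 13's `plaqHol_fieldShift₄`): `∂(fieldShift h X)(p) = ∂X(p′)` with `p′` the
plaquette at `siteShift h p.src` with the same directions. [cite: Balaban1987RG1, (0.2) p.252 (bookkeeping)] -/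
theorem plaq_fieldShift {M : Type*} [Group M] {K j K' j' : ℕ} (h : (F.P K).sitesPerDir j = (F.P K').sitesPerDir j') (X : GaugeField (F.P K') j' M)
    (p : Plaq (F.P K) j) : plaq (fieldShift h X) p = plaq X ⟨siteShift h p.src, p.μ, p.ν, p.hμν⟩ := by
  rw [plaq_eq, plaq_eq]
  simp only [fieldShift_apply]
  show X ⟨siteShift h p.src, p.μ⟩ * X ⟨siteShift h (p.src.shift p.μ), p.ν⟩ * (X ⟨siteShift h (p.src.shift p.ν), p.μ⟩)⁻¹ * (X ⟨siteShift h p.src, p.ν⟩)⁻¹ = _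
  rw [siteShift_shift, siteShift_shift]

/-- **A fine bond whose ends have their blocks over the four corners of a plaquette `⟨y; μ, ν⟩` of `regionOfSet Z` is a bond of run B's region over `Z`.**
[cite: Balaban1987RG1, (1.11) p.262, (0.24)-(0.25) p.257] -/
theorem fourBlocks_subset_bonds_preimage (Z : Set (Site (F.P k) 0)) (p : Plaq (F.P k) 0) (hp : p ∈ (regionOfSet (F.P k) Z).plaqs) (b : PBond (F.P (k + 1)) 0)
    (h1 : blockOf b.src = siteShift (YMDAG.N18.TwoRunCubes.ladder F k) p.src ∨ blockOf b.src = (siteShift (YMDAG.N18.TwoRunCubes.ladder F k) p.src).shift p.μ ∨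
      blockOf b.src = (siteShift (YMDAG.N18.TwoRunCubes.ladder F k) p.src).shift p.ν ∨
      blockOf b.src = ((siteShift (YMDAG.N18.TwoRunCubes.ladder F k) p.src).shift p.μ).shift p.ν)
    (h2 : blockOf b.tgt = siteShift (YMDAG.N18.TwoRunCubes.ladder F k) p.src ∨ blockOf b.tgt = (siteShift (YMDAG.N18.TwoRunCubes.ladder F k) p.src).shift p.μ ∨
      blockOf b.tgt = (siteShift (YMDAG.N18.TwoRunCubes.ladder F k) p.src).shift p.ν ∨
      blockOf b.tgt = ((siteShift (YMDAG.N18.TwoRunCubes.ladder F k) p.src).shift p.μ).shift p.ν) :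
    b ∈ (regionOfSet (F.P (k + 1)) ((fun x => (siteShift (YMDAG.N18.TwoRunCubes.ladder F k)).symm (blockOf x)) ⁻¹' Z)).bonds := by
  obtain ⟨c1, c2, c3, c4⟩ := hp
  have key : ∀ x : Site (F.P (k + 1)) 0,
      (blockOf x = siteShift (YMDAG.N18.TwoRunCubes.ladder F k) p.src ∨ blockOf x = (siteShift (YMDAG.N18.TwoRunCubes.ladder F k) p.src).shift p.μ ∨
        blockOf x = (siteShift (YMDAG.N18.TwoRunCubes.ladder F k) p.src).shift p.ν ∨
        blockOf x = ((siteShift (YMDAG.N18.TwoRunCubes.ladder F k) p.src).shift p.μ).shift p.ν) →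
      x ∈ (fun x => (siteShift (YMDAG.N18.TwoRunCubes.ladder F k)).symm (blockOf x)) ⁻¹' Z := by
    intro x h
    show (siteShift (YMDAG.N18.TwoRunCubes.ladder F k)).symm (blockOf x) ∈ Z
    rcases h with h | h | h | h
    · rw [h, Equiv.symm_apply_apply]; exact c1
    · rw [h, ← siteShift_shift, Equiv.symm_apply_apply]; exact c2
    · rw [h, ← siteShift_shift, Equiv.symm_apply_apply]; exact c3
    · rw [h, ← siteShift_shift, ← siteShift_shift, Equiv.symm_apply_apply]; exact c4
  exact ⟨key _ h1, key _ h2⟩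

/-- **A fine plaquette whose four corners have their blocks over the four corners of a plaquette of `regionOfSet Z` is a plaquette of run B's region over `Z`.**
[cite: Balaban1987RG1, (1.11) p.262, (0.24)-(0.25) p.257] -/
theorem fourBlocks_subset_plaqs_preimage (Z : Set (Site (F.P k) 0)) (p : Plaq (F.P k) 0) (hp : p ∈ (regionOfSet (F.P k) Z).plaqs) (q : Plaq (F.P (k + 1)) 0)
    (h1 : blockOf q.src = siteShift (YMDAG.N18.TwoRunCubes.ladder F k) p.src ∨ blockOf q.src = (siteShift (YMDAG.N18.TwoRunCubes.ladder F k) p.src).shift p.μ ∨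
      blockOf q.src = (siteShift (YMDAG.N18.TwoRunCubes.ladder F k) p.src).shift p.ν ∨
      blockOf q.src = ((siteShift (YMDAG.N18.TwoRunCubes.ladder F k) p.src).shift p.μ).shift p.ν)
    (h2 : blockOf (q.src.shift q.μ) = siteShift (YMDAG.N18.TwoRunCubes.ladder F k) p.src ∨
      blockOf (q.src.shift q.μ) = (siteShift (YMDAG.N18.TwoRunCubes.ladder F k) p.src).shift p.μ ∨
      blockOf (q.src.shift q.μ) = (siteShift (YMDAG.N18.TwoRunCubes.ladder F k) p.src).shift p.ν ∨
      blockOf (q.src.shift q.μ) = ((siteShift (YMDAG.N18.TwoRunCubes.ladder F k) p.src).shift p.μ).shift p.ν)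
    (h3 : blockOf (q.src.shift q.ν) = siteShift (YMDAG.N18.TwoRunCubes.ladder F k) p.src ∨
      blockOf (q.src.shift q.ν) = (siteShift (YMDAG.N18.TwoRunCubes.ladder F k) p.src).shift p.μ ∨
      blockOf (q.src.shift q.ν) = (siteShift (YMDAG.N18.TwoRunCubes.ladder F k) p.src).shift p.ν ∨
      blockOf (q.src.shift q.ν) = ((siteShift (YMDAG.N18.TwoRunCubes.ladder F k) p.src).shift p.μ).shift p.ν)
    (h4 : blockOf ((q.src.shift q.μ).shift q.ν) = siteShift (YMDAG.N18.TwoRunCubes.ladder F k) p.src ∨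
      blockOf ((q.src.shift q.μ).shift q.ν) = (siteShift (YMDAG.N18.TwoRunCubes.ladder F k) p.src).shift p.μ ∨
      blockOf ((q.src.shift q.μ).shift q.ν) = (siteShift (YMDAG.N18.TwoRunCubes.ladder F k) p.src).shift p.ν ∨
      blockOf ((q.src.shift q.μ).shift q.ν) = ((siteShift (YMDAG.N18.TwoRunCubes.ladder F k) p.src).shift p.μ).shift p.ν) :
    q ∈ (regionOfSet (F.P (k + 1)) ((fun x => (siteShift (YMDAG.N18.TwoRunCubes.ladder F k)).symm (blockOf x)) ⁻¹' Z)).plaqs := by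
  obtain ⟨c1, c2, c3, c4⟩ := hp
  have key : ∀ x : Site (F.P (k + 1)) 0,
      (blockOf x = siteShift (YMDAG.N18.TwoRunCubes.ladder F k) p.src ∨ blockOf x = (siteShift (YMDAG.N18.TwoRunCubes.ladder F k) p.src).shift p.μ ∨
        blockOf x = (siteShift (YMDAG.N18.TwoRunCubes.ladder F k) p.src).shift p.ν ∨
        blockOf x = ((siteShift (YMDAG.N18.TwoRunCubes.ladder F k) p.src).shift p.μ).shift p.ν) →
      x ∈ (fun x => (siteShift (YMDAG.N18.TwoRunCubes.ladder F k)).symm (blockOf x)) ⁻¹' Z := by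
    intro x h
    show (siteShift (YMDAG.N18.TwoRunCubes.ladder F k)).symm (blockOf x) ∈ Z
    rcases h with h | h | h | h
    · rw [h, Equiv.symm_apply_apply]; exact c1
    · rw [h, ← siteShift_shift, Equiv.symm_apply_apply]; exact c2
    · rw [h, ← siteShift_shift, Equiv.symm_apply_apply]; exact c3
    · rw [h, ← siteShift_shift, ← siteShift_shift, Equiv.symm_apply_apply]; exact c4
  exact ⟨key _ h1, key _ h2, key _ h3, key _ h4⟩

/-- ★★★★ **THE AVERAGED FACTOR, READ ON RUN A, IS `SU(N)`-VALUED AT EVERY FRAME BOND OF `Y`** (the `gValued` field of (i) for the candidate factor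
`U_A = fieldShift (avgUnits U)` of FILE 7's `hletters`): for `Y ∈ 𝐃_j` of run A and `U` the factor of condition (i) of run B on `frameI Rz M (j+1) (domSites π(j,Y))`
(constants `cB`, radius `α₀ ≥ 0`, guard `(((d+2)L)²∕4)·α₀ξ² < δ_N`), at every bond `b` of `regionOfSet (domSites Y)`. [cite: Balaban1987RG1, (1.11) p.262, (0.24)-(0.25) p.257] -/
theorem fieldShift_avgUnits_factor_mem_G_frameBond (Rz : Node00.Sect2.Residual (F.P (k + 1)) (MatA N)) (M j' : ℕ) (Y : (domSys (F.P k) M j').Dom)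
    {cB : StepConsts} {α₀ : ℝ} {U : PBond (F.P (k + 1)) 0 → (MatA N)ˣ}
    (hI : CondI (suModel N) (frameI Rz M (j' + 1) (domSites (F.P (k + 1)) M (j' + 1) (pairOfRecord F M k ⟨j', Y⟩).2)) cB α₀ U)
    (hα₀ : 0 ≤ α₀) (hguard : (((((F.P (k + 1)).d + 2) * (F.P (k + 1)).L : ℕ) : ℝ) ^ 2 / 4) * (α₀ * cB.ξ ^ 2) < deltaSU (Fin N))
    (b : PBond (F.P k) 0) (hb : b ∈ (regionOfSet (F.P k) (domSites (F.P k) M j' Y)).bonds) :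
    fieldShift (sitesPerDir_ladder F (K := k) (j := 0) rfl rfl) (avgUnits U) b ∈ (suModel N).G := by
  have hX : (frameI Rz M (j' + 1) (domSites (F.P (k + 1)) M (j' + 1) (pairOfRecord F M k ⟨j', Y⟩).2)).X =
      regionOfSet (F.P (k + 1)) ((fun x => (siteShift (YMDAG.N18.TwoRunCubes.ladder F k)).symm (blockOf x)) ⁻¹' domSites (F.P k) M j' Y) := by
    show regionOfSet (F.P (k + 1)) (domSites (F.P (k + 1)) M (j' + 1) (pairOfRecord F M k ⟨j', Y⟩).2) = _
    rw [YMDAG.N18.TwoRunCubes.domSites_pairOfRecord_eq_preimage]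
  have hj : 0 + 1 ≤ (F.P (k + 1)).m + (F.P (k + 1)).K := by simp only [T4Family.P_m, T4Family.P_K]; omega
  rw [fieldShift_apply]
  obtain ⟨yA, μA⟩ := b
  refine avgUnits_factor_mem_suModel_G hj hI _ (fun b' h1 h2 => ?_) (fun q h1 h2 h3 h4 => ?_) hα₀ hguard
  · rw [hX]; exact YMDAG.N18.AvgPotential.twoBlocks_subset_bonds_preimage F k _ hb b' h1 h2
  · rw [hX]; exact twoBlocks_subset_plaqs_preimage _ hb q h1 h2 h3 h4

/-- ★★★★ **THE AVERAGED FACTOR, READ ON RUN A, SATISFIES (1.11) AT EVERY FRAME PLAQUETTE OF `Y` WITH THE PRINT's CONSTANT**: under the hypotheses of ★★★★ above and the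
guard `(((d+4)L)²∕4)·α₀ξ² ≤ δ_N∕2`, at every plaquette `p` of `regionOfSet (domSites Y)`:
`‖∂(fieldShift (avgUnits U))(p) − 1‖ ≤ L²·(α₀ξ²) + 143·((((d+4)L)²∕4)·(α₀ξ²))²` (`ξ` = run B's unit `cB.ξ`; at the constants of record `L·ξ_B = ξ_A`, so the leading
term is `α₀ξ_A²`: [Balaban1985Averaging] (51) `L²α₀ + C₀(L²α₀)²`). [cite: Balaban1985Averaging, Prop. 1 (51) p.26; Balaban1987RG1, (1.11) p.262, (0.24)-(0.25) p.257] -/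
theorem norm_plaq_fieldShift_avgUnits_factor_sub_one_le_framePlaq (Rz : Node00.Sect2.Residual (F.P (k + 1)) (MatA N)) (M j' : ℕ) (Y : (domSys (F.P k) M j').Dom)
    {cB : StepConsts} {α₀ : ℝ} {U : PBond (F.P (k + 1)) 0 → (MatA N)ˣ}
    (hI : CondI (suModel N) (frameI Rz M (j' + 1) (domSites (F.P (k + 1)) M (j' + 1) (pairOfRecord F M k ⟨j', Y⟩).2)) cB α₀ U)
    (hα₀ : 0 ≤ α₀) (hguard : (((((F.P (k + 1)).d + 4) * (F.P (k + 1)).L : ℕ) : ℝ) ^ 2 / 4) * (α₀ * cB.ξ ^ 2) ≤ deltaSU (Fin N) / 2)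
    (p : Plaq (F.P k) 0) (hp : p ∈ (regionOfSet (F.P k) (domSites (F.P k) M j' Y)).plaqs) :
    ‖((plaq (fieldShift (sitesPerDir_ladder F (K := k) (j := 0) rfl rfl) (avgUnits U)) p : (MatA N)ˣ) : MatA N) - 1‖ ≤
      ((F.P (k + 1)).L : ℝ) ^ 2 * (α₀ * cB.ξ ^ 2) + 143 * ((((((F.P (k + 1)).d + 4) * (F.P (k + 1)).L : ℕ) : ℝ) ^ 2 / 4) * (α₀ * cB.ξ ^ 2)) ^ 2 := by
  have hX : (frameI Rz M (j' + 1) (domSites (F.P (k + 1)) M (j' + 1) (pairOfRecord F M k ⟨j', Y⟩).2)).X =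
      regionOfSet (F.P (k + 1)) ((fun x => (siteShift (YMDAG.N18.TwoRunCubes.ladder F k)).symm (blockOf x)) ⁻¹' domSites (F.P k) M j' Y) := by
    show regionOfSet (F.P (k + 1)) (domSites (F.P (k + 1)) M (j' + 1) (pairOfRecord F M k ⟨j', Y⟩).2) = _
    rw [YMDAG.N18.TwoRunCubes.domSites_pairOfRecord_eq_preimage]
  have hj : 0 + 1 ≤ (F.P (k + 1)).m + (F.P (k + 1)).K := by simp only [T4Family.P_m, T4Family.P_K]; omega
  rw [plaq_fieldShift]
  refine norm_plaq_avgUnits_factor_sub_one_le hj hI _ (fun b' h1 h2 => ?_) (fun q h1 h2 h3 h4 => ?_) hα₀ hguard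
  · rw [hX]; exact fourBlocks_subset_bonds_preimage _ p hp b' h1 h2
  · rw [hX]; exact fourBlocks_subset_plaqs_preimage _ p hp q h1 h2 h3 h4

end Record

end YMDAG.N18.TransportOfRecord

end
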